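import Mathlib
import Summits.CriticalPhenomena.PercolationContinuityZ3.Theses.PercExchangeRateTransport

/-!
# Crux idea `time-arrow-split` — Part A: the split (glue PROVED, two stub signatures); Part B: tightness certificates (PROVED)

Part A — sketch for crux idea `time-arrow-split` for `TransportLemma` (stmt-CriticalPhenomena-16063)

The transport lemma splits by the ARROW OF TIME rather than by the side of the threshold:

* `TransportDown`  : `J` is nonincreasing in `t` — needs the two-sided exchange inequality on the
  closed RIGHT collar but only the LOWER one-sided bound `∂ₜΘ ≥ (a − η) ∂ₚΘ` on the left `δ(η)`-strip;
* `TransportUp`    : `J` is nondecreasing in `t` — needs only the UPPER one-sided bound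
  `∂ₜΘ ≤ (a + η) ∂ₚΘ` on the left strip.

Neither half assumes monotonicity of `Θ n` in `t`.  `transportLemma_of_down_up` (proved below,
sorry-free) shows `TransportDown → TransportUp → TransportLemma` (the crux BY NAME), so
`TransportDown ∧ TransportUp` is a STRONGER form `C⁺` of the crux; the route's `closes` consumes only
the `Down` half (it uses `J p₃ ≤ J lo` for `lo < p₃`).
-/

open Set

namespace Summit.CriticalPhenomena.PercolationContinuityZ3.Cruxes.TransportLemma.TimeArrow

/-- `C↓⁺`: forward (nonincreasing-in-`t`) transport of the critical level under the LOWER one-sided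
exchange bound below the curve. -/
def TransportDown : Prop :=
  ∀ (Θ : ℕ → ℝ → ℝ → ℝ) (pc : ℝ → ℝ) (a : ℝ → ℝ → ℝ) (lo hi ρ L : ℝ), 0 < lo → lo < hi → hi < 1 →
    0 < ρ →
    (∀ n, ContDiffOn ℝ 1 (fun x : ℝ × ℝ => Θ n x.1 x.2) (Set.Ioo 0 1 ×ˢ Set.Ioo 0 1)) →
    (∀ n t, Monotone (fun p => Θ n p t)) →
    (∀ p t, Antitone (fun n => Θ n p t)) →
    (∀ n p t, 0 ≤ Θ n p t) →
    ContinuousOn pc (Set.Icc lo hi) →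
    (∀ t ∈ Set.Icc lo hi, ρ < pc t ∧ pc t + ρ < 1) →
    (∀ t ∈ Set.Icc lo hi, ∀ p : ℝ,
        (p < pc t → (⨅ n, Θ n p t) = 0) ∧ (pc t < p → 0 < ⨅ n, Θ n p t)) →
    ContinuousOn (fun x : ℝ × ℝ => a x.1 x.2)
        {x : ℝ × ℝ | x.2 ∈ Set.Icc lo hi ∧ |x.1 - pc x.2| ≤ ρ} →
    (∀ t ∈ Set.Icc lo hi, ∀ p q : ℝ, pc t ≤ p → p ≤ pc t + ρ → pc t ≤ q → q ≤ pc t + ρ →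
        |a p t - a q t| ≤ L * |p - q|) →
    -- two-sided exchange inequality on the closed RIGHT collar (K⁺-type input)
    (∀ η > (0 : ℝ), ∃ m : ℕ, ∀ n ≥ m, ∀ t ∈ Set.Icc lo hi, ∀ p : ℝ, pc t ≤ p → p ≤ pc t + ρ →
        |deriv (fun s => Θ n p s) t - a p t * deriv (fun q => Θ n q t) p|
          ≤ η * deriv (fun q => Θ n q t) p) →
    -- ONE-SIDED (lower) exchange inequality on the LEFT δ(η)-strip (half of the K⁻-type input)
    (∀ η > (0 : ℝ), ∃ δ > (0 : ℝ), ∃ m : ℕ, ∀ n ≥ m, ∀ t ∈ Set.Icc lo hi, ∀ p : ℝ,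
        pc t - δ ≤ p → p ≤ pc t →
        -(η * deriv (fun q => Θ n q t) p)
          ≤ deriv (fun s => Θ n p s) t - a p t * deriv (fun q => Θ n q t) p) →
    ∀ t₀ ∈ Set.Icc lo hi, ∀ t₁ ∈ Set.Icc lo hi, t₀ ≤ t₁ →
      (⨅ n, Θ n (pc t₁) t₁) ≤ ⨅ n, Θ n (pc t₀) t₀

/-- `C↑⁺`: backward (nondecreasing-in-`t`) transport under the UPPER one-sided bound below the curve. -/
def TransportUp : Prop :=
  ∀ (Θ : ℕ → ℝ → ℝ → ℝ) (pc : ℝ → ℝ) (a : ℝ → ℝ → ℝ) (lo hi ρ L : ℝ), 0 < lo → lo < hi → hi < 1 →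
    0 < ρ →
    (∀ n, ContDiffOn ℝ 1 (fun x : ℝ × ℝ => Θ n x.1 x.2) (Set.Ioo 0 1 ×ˢ Set.Ioo 0 1)) →
    (∀ n t, Monotone (fun p => Θ n p t)) →
    (∀ p t, Antitone (fun n => Θ n p t)) →
    (∀ n p t, 0 ≤ Θ n p t) →
    ContinuousOn pc (Set.Icc lo hi) →
    (∀ t ∈ Set.Icc lo hi, ρ < pc t ∧ pc t + ρ < 1) →
    (∀ t ∈ Set.Icc lo hi, ∀ p : ℝ,
        (p < pc t → (⨅ n, Θ n p t) = 0) ∧ (pc t < p → 0 < ⨅ n, Θ n p t)) →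
    ContinuousOn (fun x : ℝ × ℝ => a x.1 x.2)
        {x : ℝ × ℝ | x.2 ∈ Set.Icc lo hi ∧ |x.1 - pc x.2| ≤ ρ} →
    (∀ t ∈ Set.Icc lo hi, ∀ p q : ℝ, pc t ≤ p → p ≤ pc t + ρ → pc t ≤ q → q ≤ pc t + ρ →
        |a p t - a q t| ≤ L * |p - q|) →
    (∀ η > (0 : ℝ), ∃ m : ℕ, ∀ n ≥ m, ∀ t ∈ Set.Icc lo hi, ∀ p : ℝ, pc t ≤ p → p ≤ pc t + ρ →
        |deriv (fun s => Θ n p s) t - a p t * deriv (fun q => Θ n q t) p|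
          ≤ η * deriv (fun q => Θ n q t) p) →
    -- ONE-SIDED (upper) exchange inequality on the LEFT δ(η)-strip (the other half of K⁻)
    (∀ η > (0 : ℝ), ∃ δ > (0 : ℝ), ∃ m : ℕ, ∀ n ≥ m, ∀ t ∈ Set.Icc lo hi, ∀ p : ℝ,
        pc t - δ ≤ p → p ≤ pc t →
        deriv (fun s => Θ n p s) t - a p t * deriv (fun q => Θ n q t) p
          ≤ η * deriv (fun q => Θ n q t) p) →
    ∀ t₀ ∈ Set.Icc lo hi, ∀ t₁ ∈ Set.Icc lo hi, t₀ ≤ t₁ →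
      (⨅ n, Θ n (pc t₀) t₀) ≤ ⨅ n, Θ n (pc t₁) t₁

/-- **First lemma (PROVED): the time-arrow split is a genuine strengthening of the crux.**
`TransportDown → TransportUp → TransportLemma` (the route decl, by name). -/
theorem transportLemma_of_down_up (hD : TransportDown) (hU : TransportUp) :
    Summit.CriticalPhenomena.PercolationContinuityZ3.Theses.PercExchangeRateTransport.TransportLemma := by
  intro Θ pc a lo hi ρ L hlo hlohi hhi hρ hC1 hmp _hmt hanti hnn hpc hcollar hthr ha hLip hex t ht
  -- the two-sided inequality restricted to the closed right collar
  have hexR : ∀ η > (0 : ℝ), ∃ m : ℕ, ∀ n ≥ m, ∀ t ∈ Set.Icc lo hi, ∀ p : ℝ,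
      pc t ≤ p → p ≤ pc t + ρ →
      |deriv (fun s => Θ n p s) t - a p t * deriv (fun q => Θ n q t) p|
        ≤ η * deriv (fun q => Θ n q t) p := by
    intro η hη
    obtain ⟨δ, hδ, m, hm⟩ := hex η hη
    exact ⟨m, fun n hn t ht p h1 h2 => hm n hn t ht p (by linarith) h2⟩
  -- its lower half on the left strip
  have hexLo : ∀ η > (0 : ℝ), ∃ δ > (0 : ℝ), ∃ m : ℕ, ∀ n ≥ m, ∀ t ∈ Set.Icc lo hi, ∀ p : ℝ,
      pc t - δ ≤ p → p ≤ pc t →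
      -(η * deriv (fun q => Θ n q t) p)
        ≤ deriv (fun s => Θ n p s) t - a p t * deriv (fun q => Θ n q t) p := by
    intro η hη
    obtain ⟨δ, hδ, m, hm⟩ := hex η hη
    refine ⟨δ, hδ, m, fun n hn t ht p h1 h2 => ?_⟩
    exact (abs_le.1 (hm n hn t ht p h1 (by linarith))).1
  -- its upper half on the left strip
  have hexUp : ∀ η > (0 : ℝ), ∃ δ > (0 : ℝ), ∃ m : ℕ, ∀ n ≥ m, ∀ t ∈ Set.Icc lo hi, ∀ p : ℝ,
      pc t - δ ≤ p → p ≤ pc t →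
      deriv (fun s => Θ n p s) t - a p t * deriv (fun q => Θ n q t) p
        ≤ η * deriv (fun q => Θ n q t) p := by
    intro η hη
    obtain ⟨δ, hδ, m, hm⟩ := hex η hη
    refine ⟨δ, hδ, m, fun n hn t ht p h1 h2 => ?_⟩
    exact (abs_le.1 (hm n hn t ht p h1 (by linarith))).2
  have hhi' : hi ∈ Set.Icc lo hi := ⟨hlohi.le, le_rfl⟩
  apply le_antisymm
  · exact hU Θ pc a lo hi ρ L hlo hlohi hhi hρ hC1 hmp hanti hnn hpc hcollar hthr ha hLip hexR hexUp
      t ht hi hhi' ht.2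
  · exact hD Θ pc a lo hi ρ L hlo hlohi hhi hρ hC1 hmp hanti hnn hpc hcollar hthr ha hLip hexR hexLo
      t ht hi hhi' ht.2

/-- **Load-bearing stub of the `Down` half — the forward upper fence from the LOWER bound only.**
Positivity propagation along one straight "slow" segment issued from `(pc t₀ + ε, t₀)`, which may dip
below the curve only inside the `δ(η)`-strip, where the lower one-sided bound suffices
(`fence_monotoneOn` of `Lines/corrector.lean` uses exactly `(abs_le.1 _).1`).  Moduli `A, ω, τ`
handed in as in `corrector.stub_upperFence`. -/
theorem stub_forwardUpperFence_oneSided :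
    ∀ (Θ : ℕ → ℝ → ℝ → ℝ) (pc : ℝ → ℝ) (a : ℝ → ℝ → ℝ) (lo hi ρ A : ℝ),
      0 < lo → lo < hi → hi < 1 → 0 < ρ →
      (∀ n, ContDiffOn ℝ 1 (fun x : ℝ × ℝ => Θ n x.1 x.2) (Set.Ioo 0 1 ×ˢ Set.Ioo 0 1)) →
      (∀ n t, Monotone (fun p => Θ n p t)) →
      (∀ p t, Antitone (fun n => Θ n p t)) →
      (∀ n p t, 0 ≤ Θ n p t) →
      (∀ t ∈ Set.Icc lo hi, ρ < pc t ∧ pc t + ρ < 1) →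
      (∀ t ∈ Set.Icc lo hi, ∀ p : ℝ,
          (p < pc t → (⨅ n, Θ n p t) = 0) ∧ (pc t < p → 0 < ⨅ n, Θ n p t)) →
      (∀ t ∈ Set.Icc lo hi, ∀ p : ℝ, |p - pc t| ≤ ρ → |a p t| ≤ A) →
      (∀ η > (0 : ℝ), ∃ ω > (0 : ℝ), ∀ t ∈ Set.Icc lo hi, ∀ t' ∈ Set.Icc lo hi, ∀ p p' : ℝ,
          |p - pc t| ≤ ρ → |p' - pc t'| ≤ ρ → |t - t'| ≤ ω → |p - p'| ≤ ω →
          |a p t - a p' t'| ≤ η) →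
      (∀ κ > (0 : ℝ), ∃ τ > (0 : ℝ), ∀ t ∈ Set.Icc lo hi, ∀ t' ∈ Set.Icc lo hi,
          |t - t'| ≤ τ → |pc t - pc t'| ≤ κ) →
      (∀ η > (0 : ℝ), ∃ δ > (0 : ℝ), ∃ m : ℕ, ∀ n ≥ m, ∀ t ∈ Set.Icc lo hi, ∀ p : ℝ,
          pc t - δ ≤ p → p ≤ pc t + ρ →
          -(η * deriv (fun q => Θ n q t) p)
            ≤ deriv (fun s => Θ n p s) t - a p t * deriv (fun q => Θ n q t) p) →
      ∀ η > (0 : ℝ), ∃ τ > (0 : ℝ), ∀ t₀ ∈ Set.Icc lo hi, ∀ s ∈ Set.Icc lo hi, t₀ ≤ s → s - t₀ ≤ τ →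
        pc s - pc t₀ + a (pc t₀) t₀ * (s - t₀) ≤ η * (s - t₀) := by
  sorry

/-- **Second stub of the `Down` half — the fast STAIRCASE (level transport without a `C¹` curve).**
Under the `Down` hypotheses plus the forward upper fence, for `t₀ ≤ t₁` in `[lo,hi]` and every small
`ε > 0`: `⨅ₙ Θ n (pc t₁) t₁ ≤ ⨅ₙ Θ n (pc t₀ + ε) t₀`.  Proof sketch: grid `t₀ = s₀ < … < s_N = t₁`
of mesh `h`; on each block ONE straight fast segment of slope `−(a(pc sₖ + εₖ, sₖ) + 2η)` issued
from `(pc sₖ + εₖ, sₖ)` (`fence_antitoneOn`, right-collar two-sided bound), re-based to the curve at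
`sₖ₊₁` with the discrete-Grönwall budget `εₖ₊₁ = εₖ (1 − L h) − 3 η h > 0` (forward upper fence +
Lipschitz clause); exits through the TOP of the collar are harmless (re-base lower, monotone in `p`).
No differentiability of `pc`, no ODE, no polygon.  With `birth.rightContinuity` (proved) it gives
`TransportDown`. -/
theorem stub_staircaseDown :
    ∀ (Θ : ℕ → ℝ → ℝ → ℝ) (pc : ℝ → ℝ) (a : ℝ → ℝ → ℝ) (lo hi ρ L : ℝ), 0 < lo → lo < hi → hi < 1 →
      0 < ρ →
      (∀ n, ContDiffOn ℝ 1 (fun x : ℝ × ℝ => Θ n x.1 x.2) (Set.Ioo 0 1 ×ˢ Set.Ioo 0 1)) →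
      (∀ n t, Monotone (fun p => Θ n p t)) →
      (∀ p t, Antitone (fun n => Θ n p t)) →
      (∀ n p t, 0 ≤ Θ n p t) →
      ContinuousOn pc (Set.Icc lo hi) →
      (∀ t ∈ Set.Icc lo hi, ρ < pc t ∧ pc t + ρ < 1) →
      ContinuousOn (fun x : ℝ × ℝ => a x.1 x.2)
          {x : ℝ × ℝ | x.2 ∈ Set.Icc lo hi ∧ |x.1 - pc x.2| ≤ ρ} →
      (∀ t ∈ Set.Icc lo hi, ∀ p q : ℝ, pc t ≤ p → p ≤ pc t + ρ → pc t ≤ q → q ≤ pc t + ρ →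
          |a p t - a q t| ≤ L * |p - q|) →
      -- two-sided exchange inequality on the closed right collar
      (∀ η > (0 : ℝ), ∃ m : ℕ, ∀ n ≥ m, ∀ t ∈ Set.Icc lo hi, ∀ p : ℝ, pc t ≤ p → p ≤ pc t + ρ →
          |deriv (fun s => Θ n p s) t - a p t * deriv (fun q => Θ n q t) p|
            ≤ η * deriv (fun q => Θ n q t) p) →
      -- forward upper fence (output of `stub_forwardUpperFence_oneSided`)
      (∀ η > (0 : ℝ), ∃ τ > (0 : ℝ), ∀ t₀ ∈ Set.Icc lo hi, ∀ s ∈ Set.Icc lo hi, t₀ ≤ s →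
          s - t₀ ≤ τ → pc s - pc t₀ + a (pc t₀) t₀ * (s - t₀) ≤ η * (s - t₀)) →
      ∀ t₀ ∈ Set.Icc lo hi, ∀ t₁ ∈ Set.Icc lo hi, t₀ ≤ t₁ →
        ∃ ε₀ > (0 : ℝ), ∀ ε ∈ Set.Ioo 0 ε₀,
          (⨅ n, Θ n (pc t₁) t₁) ≤ ⨅ n, Θ n (pc t₀ + ε) t₀ := by
  sorry

/-! ## Part B — Tightness certificates for the time-arrow split of `TransportLemma` (stmt-CriticalPhenomena-16063)

Kernel-checked: the UPPER one-sided exchange bound below the curve (the half of K⁻ that the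
`Up` direction consumes) does NOT give the `Down` direction `J t₁ ≤ J t₀ (t₀ ≤ t₁)` — the only
direction the route's `closes` uses (`J p₃ ≤ J lo`).  Model ("vertical critical line fed from the
right"): `Θ n p t = smoothTransition (n (p − 1/2) + 1) · exp (p + t/2)`, `pc ≡ 1/2`, `a ≡ 1/2`,
arc `[1/4,1/2]`, `ρ = 1/4`, `L = 0`.  All structural hypotheses of the crux hold (even monotonicity
in `t`), the exchange inequality is EXACT (slack 0) and two-sided on the closed right collar, the
upper one-sided bound `∂ₜΘ − a ∂ₚΘ ≤ η ∂ₚΘ` holds on the whole left half-plane for every `n`, yet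
`J t = exp (1/2 + t/2)` is strictly increasing.  Hence the LOWER bound `∂ₜΘ ≥ (a − η) ∂ₚΘ` on the
left `δ(η)`-strip is the load-bearing half of K⁻ for `closes`.
-/

open Real


/-- `Down` conclusion from the `Up` hypotheses (two-sided right collar + UPPER one-sided bound on
the left strip; monotonicity in `t` thrown in as well).  Refuted below. -/
def DownFromUpperHalf : Prop :=
  ∀ (Θ : ℕ → ℝ → ℝ → ℝ) (pc : ℝ → ℝ) (a : ℝ → ℝ → ℝ) (lo hi ρ L : ℝ), 0 < lo → lo < hi → hi < 1 →
    0 < ρ →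
    (∀ n, ContDiffOn ℝ 1 (fun x : ℝ × ℝ => Θ n x.1 x.2) (Set.Ioo 0 1 ×ˢ Set.Ioo 0 1)) →
    (∀ n t, Monotone (fun p => Θ n p t)) →
    (∀ n p, Monotone (fun t => Θ n p t)) →
    (∀ p t, Antitone (fun n => Θ n p t)) →
    (∀ n p t, 0 ≤ Θ n p t) →
    ContinuousOn pc (Set.Icc lo hi) →
    (∀ t ∈ Set.Icc lo hi, ρ < pc t ∧ pc t + ρ < 1) →
    (∀ t ∈ Set.Icc lo hi, ∀ p : ℝ,
        (p < pc t → (⨅ n, Θ n p t) = 0) ∧ (pc t < p → 0 < ⨅ n, Θ n p t)) →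
    ContinuousOn (fun x : ℝ × ℝ => a x.1 x.2)
        {x : ℝ × ℝ | x.2 ∈ Set.Icc lo hi ∧ |x.1 - pc x.2| ≤ ρ} →
    (∀ t ∈ Set.Icc lo hi, ∀ p q : ℝ, pc t ≤ p → p ≤ pc t + ρ → pc t ≤ q → q ≤ pc t + ρ →
        |a p t - a q t| ≤ L * |p - q|) →
    (∀ η > (0 : ℝ), ∃ m : ℕ, ∀ n ≥ m, ∀ t ∈ Set.Icc lo hi, ∀ p : ℝ, pc t ≤ p → p ≤ pc t + ρ →
        |deriv (fun s => Θ n p s) t - a p t * deriv (fun q => Θ n q t) p|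
          ≤ η * deriv (fun q => Θ n q t) p) →
    (∀ η > (0 : ℝ), ∃ δ > (0 : ℝ), ∃ m : ℕ, ∀ n ≥ m, ∀ t ∈ Set.Icc lo hi, ∀ p : ℝ,
        pc t - δ ≤ p → p ≤ pc t →
        deriv (fun s => Θ n p s) t - a p t * deriv (fun q => Θ n q t) p
          ≤ η * deriv (fun q => Θ n q t) p) →
    ∀ t₀ ∈ Set.Icc lo hi, ∀ t₁ ∈ Set.Icc lo hi, t₀ ≤ t₁ →
      (⨅ n, Θ n (pc t₁) t₁) ≤ ⨅ n, Θ n (pc t₀) t₀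

/-! ## The model -/

/-- `Θ n p t = ST (n (p − 1/2) + 1) · exp (p + t/2)`. -/
noncomputable def Θm (n : ℕ) (p t : ℝ) : ℝ :=
  smoothTransition ((n : ℝ) * (p - 1 / 2) + 1) * exp (p + t / 2)

theorem ST_hasDerivAt (x : ℝ) : HasDerivAt smoothTransition (deriv smoothTransition x) x :=
  ((smoothTransition.contDiff (n := 1)).differentiable (by simp) x).hasDerivAt

theorem ST_deriv_nonneg (x : ℝ) : 0 ≤ deriv smoothTransition x :=
  smoothTransition.monotone.deriv_nonneg

theorem ST_deriv_eq_zero {x : ℝ} (hx : 1 ≤ x) : deriv smoothTransition x = 0 := by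
  apply IsLocalMax.deriv_eq_zero
  filter_upwards with y
  rw [smoothTransition.one_of_one_le hx]
  exact smoothTransition.le_one y

theorem Θm_hasDerivAt_p (n : ℕ) (p t : ℝ) :
    HasDerivAt (fun q => Θm n q t)
      (deriv smoothTransition ((n : ℝ) * (p - 1 / 2) + 1) * n * exp (p + t / 2)
        + smoothTransition ((n : ℝ) * (p - 1 / 2) + 1) * exp (p + t / 2)) p := by
  have h1 : HasDerivAt (fun q : ℝ => (n : ℝ) * (q - 1 / 2) + 1) (n : ℝ) p := by
    have := (((hasDerivAt_id p).sub_const (1 / 2 : ℝ)).const_mul (n : ℝ)).add_const (1 : ℝ)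
    simpa using this
  have h2 : HasDerivAt (fun q : ℝ => smoothTransition ((n : ℝ) * (q - 1 / 2) + 1))
      (deriv smoothTransition ((n : ℝ) * (p - 1 / 2) + 1) * n) p :=
    (ST_hasDerivAt _).comp p h1
  have h3 : HasDerivAt (fun q : ℝ => exp (q + t / 2)) (exp (p + t / 2) * 1) p :=
    ((hasDerivAt_id p).add_const (t / 2)).exp
  have h4 := h2.mul h3
  have hfun : (fun q => Θm n q t)
      = fun q : ℝ => smoothTransition ((n : ℝ) * (q - 1 / 2) + 1) * exp (q + t / 2) := by
    funext q; rfl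
  rw [hfun]
  rw [mul_one] at h4
  exact h4

theorem Θm_hasDerivAt_t (n : ℕ) (p t : ℝ) :
    HasDerivAt (fun s => Θm n p s)
      (smoothTransition ((n : ℝ) * (p - 1 / 2) + 1) * (exp (p + t / 2) * (1 / 2))) t := by
  have h3 : HasDerivAt (fun s : ℝ => exp (p + s / 2)) (exp (p + t / 2) * (1 / 2)) t := by
    have hlin : HasDerivAt (fun s : ℝ => p + s / 2) (1 / 2) t := by
      have := ((hasDerivAt_id t).div_const (2 : ℝ)).const_add p
      simpa using this
    exact (Real.hasDerivAt_exp (p + t / 2)).comp t hlin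
  have := h3.const_mul (smoothTransition ((n : ℝ) * (p - 1 / 2) + 1))
  simpa [Θm] using this

theorem Θm_deriv_p (n : ℕ) (p t : ℝ) :
    deriv (fun q => Θm n q t) p
      = deriv smoothTransition ((n : ℝ) * (p - 1 / 2) + 1) * n * exp (p + t / 2)
        + smoothTransition ((n : ℝ) * (p - 1 / 2) + 1) * exp (p + t / 2) :=
  (Θm_hasDerivAt_p n p t).deriv

theorem Θm_deriv_t (n : ℕ) (p t : ℝ) :
    deriv (fun s => Θm n p s) t
      = smoothTransition ((n : ℝ) * (p - 1 / 2) + 1) * (exp (p + t / 2) * (1 / 2)) :=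
  (Θm_hasDerivAt_t n p t).deriv

theorem Θm_nonneg (n : ℕ) (p t : ℝ) : 0 ≤ Θm n p t :=
  mul_nonneg (smoothTransition.nonneg _) (exp_pos _).le

/-- On the closed right half-plane `p ≥ 1/2` the step factor is identically `1`. -/
theorem Θm_right {n : ℕ} {p : ℝ} (hp : 1 / 2 ≤ p) (t : ℝ) : Θm n p t = exp (p + t / 2) := by
  have hx : 1 ≤ (n : ℝ) * (p - 1 / 2) + 1 := by
    have : 0 ≤ (n : ℝ) * (p - 1 / 2) := mul_nonneg (Nat.cast_nonneg n) (by linarith)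
    linarith
  rw [Θm, smoothTransition.one_of_one_le hx, one_mul]

theorem iInf_Θm_right {p : ℝ} (hp : 1 / 2 ≤ p) (t : ℝ) : (⨅ n, Θm n p t) = exp (p + t / 2) := by
  have : (fun n => Θm n p t) = fun _ => exp (p + t / 2) := funext fun n => Θm_right hp t
  rw [this, ciInf_const]

theorem iInf_Θm_left {p : ℝ} (hp : p < 1 / 2) (t : ℝ) : (⨅ n, Θm n p t) = 0 := by
  have hbdd : BddBelow (Set.range fun n => Θm n p t) := ⟨0, by rintro _ ⟨n, rfl⟩; exact Θm_nonneg n p t⟩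
  obtain ⟨n₀, hn₀⟩ := exists_nat_gt (1 / (1 / 2 - p))
  have hgap : 0 < 1 / 2 - p := by linarith
  have hn₀' : 1 ≤ (n₀ : ℝ) * (1 / 2 - p) := by
    have := (div_lt_iff₀ hgap).1 hn₀
    linarith
  have hzero : Θm n₀ p t = 0 := by
    have hx : (n₀ : ℝ) * (p - 1 / 2) + 1 ≤ 0 := by nlinarith
    rw [Θm, smoothTransition.zero_of_nonpos hx, zero_mul]
  apply le_antisymm
  · calc (⨅ n, Θm n p t) ≤ Θm n₀ p t := ciInf_le hbdd n₀
      _ = 0 := hzero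
  · exact le_ciInf fun n => Θm_nonneg n p t

/-! ## The refutation -/

theorem not_downFromUpperHalf : ¬ DownFromUpperHalf := by
  intro h
  have key := h Θm (fun _ => 1 / 2) (fun _ _ => 1 / 2) (1 / 4) (1 / 2) (1 / 4) 0
    (by norm_num) (by norm_num) (by norm_num) (by norm_num)
  -- discharge the hypotheses one by one
  have H1 : ∀ n, ContDiffOn ℝ 1 (fun x : ℝ × ℝ => Θm n x.1 x.2) (Set.Ioo 0 1 ×ˢ Set.Ioo 0 1) := by
    intro n
    apply ContDiff.contDiffOn
    unfold Θm
    apply ContDiff.mul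
    · exact smoothTransition.contDiff.comp (by fun_prop)
    · exact Real.contDiff_exp.comp (by fun_prop)
  have H2 : ∀ n t, Monotone (fun p => Θm n p t) := by
    intro n t p q hpq
    unfold Θm
    apply mul_le_mul
    · exact smoothTransition.monotone (by nlinarith [Nat.cast_nonneg (α := ℝ) n])
    · exact exp_le_exp.2 (by linarith)
    · exact (exp_pos _).le
    · exact smoothTransition.nonneg _
  have H3 : ∀ n p, Monotone (fun t => Θm n p t) := by
    intro n p s t hst
    unfold Θm
    apply mul_le_mul_of_nonneg_left _ (smoothTransition.nonneg _)
    exact exp_le_exp.2 (by linarith)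
  have H4 : ∀ p t, Antitone (fun n => Θm n p t) := by
    intro p t m n hmn
    show Θm n p t ≤ Θm m p t
    rcases le_or_gt p (1 / 2) with hp | hp
    · unfold Θm
      apply mul_le_mul_of_nonneg_right _ (exp_pos _).le
      apply smoothTransition.monotone
      have : (m : ℝ) ≤ n := by exact_mod_cast hmn
      nlinarith
    · rw [Θm_right hp.le, Θm_right hp.le]
  have H5 : ∀ n p t, 0 ≤ Θm n p t := Θm_nonneg
  have H6 : ContinuousOn (fun _ : ℝ => (1 / 2 : ℝ)) (Set.Icc (1 / 4) (1 / 2)) := continuousOn_const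
  have H7 : ∀ t ∈ Set.Icc (1 / 4 : ℝ) (1 / 2), (1 / 4 : ℝ) < 1 / 2 ∧ (1 / 2 : ℝ) + 1 / 4 < 1 := by
    intro t _; norm_num
  have H8 : ∀ t ∈ Set.Icc (1 / 4 : ℝ) (1 / 2), ∀ p : ℝ,
      (p < 1 / 2 → (⨅ n, Θm n p t) = 0) ∧ (1 / 2 < p → 0 < ⨅ n, Θm n p t) := by
    intro t _ p
    refine ⟨fun hp => iInf_Θm_left hp t, fun hp => ?_⟩
    rw [iInf_Θm_right hp.le]
    exact exp_pos _
  have H9 : ContinuousOn (fun x : ℝ × ℝ => (1 / 2 : ℝ))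
      {x : ℝ × ℝ | x.2 ∈ Set.Icc (1 / 4 : ℝ) (1 / 2) ∧ |x.1 - 1 / 2| ≤ 1 / 4} := continuousOn_const
  have H10 : ∀ t ∈ Set.Icc (1 / 4 : ℝ) (1 / 2), ∀ p q : ℝ, 1 / 2 ≤ p → p ≤ 1 / 2 + 1 / 4 →
      1 / 2 ≤ q → q ≤ 1 / 2 + 1 / 4 → |(1 / 2 : ℝ) - 1 / 2| ≤ 0 * |p - q| := by
    intros; simp
  -- exact two-sided transport on the closed right collar
  have H11 : ∀ η > (0 : ℝ), ∃ m : ℕ, ∀ n ≥ m, ∀ t ∈ Set.Icc (1 / 4 : ℝ) (1 / 2), ∀ p : ℝ,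
      1 / 2 ≤ p → p ≤ 1 / 2 + 1 / 4 →
      |deriv (fun s => Θm n p s) t - 1 / 2 * deriv (fun q => Θm n q t) p|
        ≤ η * deriv (fun q => Θm n q t) p := by
    intro η hη
    refine ⟨0, fun n _ t _ p hp _ => ?_⟩
    have hx : 1 ≤ (n : ℝ) * (p - 1 / 2) + 1 := by
      have : 0 ≤ (n : ℝ) * (p - 1 / 2) := mul_nonneg (Nat.cast_nonneg n) (by linarith)
      linarith
    rw [Θm_deriv_t, Θm_deriv_p, ST_deriv_eq_zero hx, smoothTransition.one_of_one_le hx]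
    have hpos : 0 ≤ η * exp (p + t / 2) := mul_nonneg hη.le (exp_pos _).le
    rw [abs_le]
    constructor <;> nlinarith [hpos]
  -- the UPPER one-sided bound below the curve, for every n and every p (slack 0)
  have H12 : ∀ η > (0 : ℝ), ∃ δ > (0 : ℝ), ∃ m : ℕ, ∀ n ≥ m, ∀ t ∈ Set.Icc (1 / 4 : ℝ) (1 / 2),
      ∀ p : ℝ, 1 / 2 - δ ≤ p → p ≤ 1 / 2 →
      deriv (fun s => Θm n p s) t - 1 / 2 * deriv (fun q => Θm n q t) p
        ≤ η * deriv (fun q => Θm n q t) p := by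
    intro η hη
    refine ⟨1 / 4, by norm_num, 0, fun n _ t _ p _ _ => ?_⟩
    rw [Θm_deriv_t, Θm_deriv_p]
    have hS := ST_deriv_nonneg ((n : ℝ) * (p - 1 / 2) + 1)
    have hT := smoothTransition.nonneg ((n : ℝ) * (p - 1 / 2) + 1)
    have hE := (exp_pos (p + t / 2)).le
    have hn := Nat.cast_nonneg (α := ℝ) n
    have h1 : 0 ≤ deriv smoothTransition ((n : ℝ) * (p - 1 / 2) + 1) * n * exp (p + t / 2) :=
      mul_nonneg (mul_nonneg hS hn) hE
    have h2 : 0 ≤ smoothTransition ((n : ℝ) * (p - 1 / 2) + 1) * exp (p + t / 2) := mul_nonneg hT hE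
    nlinarith [mul_nonneg hη.le (add_nonneg h1 h2)]
  have hJ := key H1 H2 H3 H4 H5 H6 H7 H8 H9 H10 H11 H12 (1 / 4) ⟨le_rfl, by norm_num⟩ (1 / 2)
    ⟨by norm_num, le_rfl⟩ (by norm_num)
  -- but J t = exp (1/2 + t/2) is strictly increasing
  rw [iInf_Θm_right le_rfl, iInf_Θm_right le_rfl] at hJ
  have : exp ((1 : ℝ) / 2 + 1 / 4 / 2) < exp (1 / 2 + 1 / 2 / 2) := exp_lt_exp.2 (by norm_num)
  linarith

/-! ## The mirror certificate: the LOWER half does not give the `Up` direction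

Model ("tilted critical line, level transported horizontally"):
`Θ₂ n p t = smoothTransition (n (p + t/2 − 3/4) + 1) · exp p`, `pc t = 3/4 − t/2`, `a ≡ 0`,
arc `[1/4,1/2]`, `ρ = 1/4`, `L = 0`: two-sided exact on the right collar, the LOWER one-sided bound
`−η ∂ₚΘ ≤ ∂ₜΘ − a ∂ₚΘ` on the whole left region for every `n`, yet `J t = exp (3/4 − t/2)` is
strictly DEcreasing — so `J t₀ ≤ J t₁` fails.  (Paper version: the refuter's right-only family
`ST(n(p+t−c)+1)·G(p+t/2)`, rattack 2026-08-17.)  Together with `not_downFromUpperHalf`: the two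
one-sided halves of the left-strip hypothesis serve the two time directions separately, and
`TransportDown ∧ TransportUp` is a STRICT strengthening of the crux. -/

/-- `Up` conclusion from the `Down` hypotheses (two-sided right collar + LOWER one-sided bound on
the left strip; monotonicity in `t` thrown in).  Refuted below. -/
def UpFromLowerHalf : Prop :=
  ∀ (Θ : ℕ → ℝ → ℝ → ℝ) (pc : ℝ → ℝ) (a : ℝ → ℝ → ℝ) (lo hi ρ L : ℝ), 0 < lo → lo < hi → hi < 1 →
    0 < ρ →
    (∀ n, ContDiffOn ℝ 1 (fun x : ℝ × ℝ => Θ n x.1 x.2) (Set.Ioo 0 1 ×ˢ Set.Ioo 0 1)) →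
    (∀ n t, Monotone (fun p => Θ n p t)) →
    (∀ n p, Monotone (fun t => Θ n p t)) →
    (∀ p t, Antitone (fun n => Θ n p t)) →
    (∀ n p t, 0 ≤ Θ n p t) →
    ContinuousOn pc (Set.Icc lo hi) →
    (∀ t ∈ Set.Icc lo hi, ρ < pc t ∧ pc t + ρ < 1) →
    (∀ t ∈ Set.Icc lo hi, ∀ p : ℝ,
        (p < pc t → (⨅ n, Θ n p t) = 0) ∧ (pc t < p → 0 < ⨅ n, Θ n p t)) →
    ContinuousOn (fun x : ℝ × ℝ => a x.1 x.2)
        {x : ℝ × ℝ | x.2 ∈ Set.Icc lo hi ∧ |x.1 - pc x.2| ≤ ρ} →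
    (∀ t ∈ Set.Icc lo hi, ∀ p q : ℝ, pc t ≤ p → p ≤ pc t + ρ → pc t ≤ q → q ≤ pc t + ρ →
        |a p t - a q t| ≤ L * |p - q|) →
    (∀ η > (0 : ℝ), ∃ m : ℕ, ∀ n ≥ m, ∀ t ∈ Set.Icc lo hi, ∀ p : ℝ, pc t ≤ p → p ≤ pc t + ρ →
        |deriv (fun s => Θ n p s) t - a p t * deriv (fun q => Θ n q t) p|
          ≤ η * deriv (fun q => Θ n q t) p) →
    (∀ η > (0 : ℝ), ∃ δ > (0 : ℝ), ∃ m : ℕ, ∀ n ≥ m, ∀ t ∈ Set.Icc lo hi, ∀ p : ℝ,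
        pc t - δ ≤ p → p ≤ pc t →
        -(η * deriv (fun q => Θ n q t) p)
          ≤ deriv (fun s => Θ n p s) t - a p t * deriv (fun q => Θ n q t) p) →
    ∀ t₀ ∈ Set.Icc lo hi, ∀ t₁ ∈ Set.Icc lo hi, t₀ ≤ t₁ →
      (⨅ n, Θ n (pc t₀) t₀) ≤ ⨅ n, Θ n (pc t₁) t₁

/-- `Θ₂ n p t = ST (n (p + t/2 − 3/4) + 1) · exp p`. -/
noncomputable def Θ₂ (n : ℕ) (p t : ℝ) : ℝ :=
  smoothTransition ((n : ℝ) * (p + t / 2 - 3 / 4) + 1) * exp p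

theorem Θ₂_hasDerivAt_p (n : ℕ) (p t : ℝ) :
    HasDerivAt (fun q => Θ₂ n q t)
      (deriv smoothTransition ((n : ℝ) * (p + t / 2 - 3 / 4) + 1) * n * exp p
        + smoothTransition ((n : ℝ) * (p + t / 2 - 3 / 4) + 1) * exp p) p := by
  have h1 : HasDerivAt (fun q : ℝ => (n : ℝ) * (q + t / 2 - 3 / 4) + 1) (n : ℝ) p := by
    have := ((((hasDerivAt_id p).add_const (t / 2)).sub_const (3 / 4 : ℝ)).const_mul
      (n : ℝ)).add_const (1 : ℝ)
    simpa using this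
  have h2 : HasDerivAt (fun q : ℝ => smoothTransition ((n : ℝ) * (q + t / 2 - 3 / 4) + 1))
      (deriv smoothTransition ((n : ℝ) * (p + t / 2 - 3 / 4) + 1) * n) p :=
    (ST_hasDerivAt _).comp p h1
  have h3 : HasDerivAt (fun q : ℝ => exp q) (exp p) p := Real.hasDerivAt_exp p
  have h4 := h2.mul h3
  have hfun : (fun q => Θ₂ n q t)
      = fun q : ℝ => smoothTransition ((n : ℝ) * (q + t / 2 - 3 / 4) + 1) * exp q := by
    funext q; rfl
  rw [hfun]
  exact h4

theorem Θ₂_hasDerivAt_t (n : ℕ) (p t : ℝ) :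
    HasDerivAt (fun s => Θ₂ n p s)
      (deriv smoothTransition ((n : ℝ) * (p + t / 2 - 3 / 4) + 1) * (n * (1 / 2)) * exp p) t := by
  have h1 : HasDerivAt (fun s : ℝ => (n : ℝ) * (p + s / 2 - 3 / 4) + 1) ((n : ℝ) * (1 / 2)) t := by
    have := ((((hasDerivAt_id t).div_const (2 : ℝ)).const_add p).sub_const (3 / 4 : ℝ)).const_mul
      (n : ℝ) |>.add_const (1 : ℝ)
    simpa using this
  have h2 : HasDerivAt (fun s : ℝ => smoothTransition ((n : ℝ) * (p + s / 2 - 3 / 4) + 1))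
      (deriv smoothTransition ((n : ℝ) * (p + t / 2 - 3 / 4) + 1) * (n * (1 / 2))) t :=
    (ST_hasDerivAt _).comp t h1
  have h4 := h2.mul_const (exp p)
  have hfun : (fun s => Θ₂ n p s)
      = fun s : ℝ => smoothTransition ((n : ℝ) * (p + s / 2 - 3 / 4) + 1) * exp p := by
    funext s; rfl
  rw [hfun]
  exact h4

theorem Θ₂_deriv_p (n : ℕ) (p t : ℝ) :
    deriv (fun q => Θ₂ n q t) p
      = deriv smoothTransition ((n : ℝ) * (p + t / 2 - 3 / 4) + 1) * n * exp p
        + smoothTransition ((n : ℝ) * (p + t / 2 - 3 / 4) + 1) * exp p :=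
  (Θ₂_hasDerivAt_p n p t).deriv

theorem Θ₂_deriv_t (n : ℕ) (p t : ℝ) :
    deriv (fun s => Θ₂ n p s) t
      = deriv smoothTransition ((n : ℝ) * (p + t / 2 - 3 / 4) + 1) * (n * (1 / 2)) * exp p :=
  (Θ₂_hasDerivAt_t n p t).deriv

theorem Θ₂_nonneg (n : ℕ) (p t : ℝ) : 0 ≤ Θ₂ n p t :=
  mul_nonneg (smoothTransition.nonneg _) (exp_pos _).le

theorem Θ₂_right {n : ℕ} {p t : ℝ} (hp : 3 / 4 - t / 2 ≤ p) : Θ₂ n p t = exp p := by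
  have hx : 1 ≤ (n : ℝ) * (p + t / 2 - 3 / 4) + 1 := by
    have : 0 ≤ (n : ℝ) * (p + t / 2 - 3 / 4) := mul_nonneg (Nat.cast_nonneg n) (by linarith)
    linarith
  rw [Θ₂, smoothTransition.one_of_one_le hx, one_mul]

theorem iInf_Θ₂_right {p t : ℝ} (hp : 3 / 4 - t / 2 ≤ p) : (⨅ n, Θ₂ n p t) = exp p := by
  have : (fun n => Θ₂ n p t) = fun _ => exp p := funext fun n => Θ₂_right hp
  rw [this, ciInf_const]

theorem iInf_Θ₂_left {p t : ℝ} (hp : p < 3 / 4 - t / 2) : (⨅ n, Θ₂ n p t) = 0 := by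
  have hbdd : BddBelow (Set.range fun n => Θ₂ n p t) :=
    ⟨0, by rintro _ ⟨n, rfl⟩; exact Θ₂_nonneg n p t⟩
  have hgap : 0 < 3 / 4 - t / 2 - p := by linarith
  obtain ⟨n₀, hn₀⟩ := exists_nat_gt (1 / (3 / 4 - t / 2 - p))
  have hn₀' : 1 ≤ (n₀ : ℝ) * (3 / 4 - t / 2 - p) := by
    have := (div_lt_iff₀ hgap).1 hn₀
    linarith
  have hzero : Θ₂ n₀ p t = 0 := by
    have hx : (n₀ : ℝ) * (p + t / 2 - 3 / 4) + 1 ≤ 0 := by nlinarith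
    rw [Θ₂, smoothTransition.zero_of_nonpos hx, zero_mul]
  apply le_antisymm
  · calc (⨅ n, Θ₂ n p t) ≤ Θ₂ n₀ p t := ciInf_le hbdd n₀
      _ = 0 := hzero
  · exact le_ciInf fun n => Θ₂_nonneg n p t

theorem not_upFromLowerHalf : ¬ UpFromLowerHalf := by
  intro h
  have key := h Θ₂ (fun t => 3 / 4 - t / 2) (fun _ _ => 0) (1 / 4) (1 / 2) (1 / 4) 0
    (by norm_num) (by norm_num) (by norm_num) (by norm_num)
  have H1 : ∀ n, ContDiffOn ℝ 1 (fun x : ℝ × ℝ => Θ₂ n x.1 x.2) (Set.Ioo 0 1 ×ˢ Set.Ioo 0 1) := by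
    intro n
    apply ContDiff.contDiffOn
    unfold Θ₂
    apply ContDiff.mul
    · exact smoothTransition.contDiff.comp (by fun_prop)
    · exact Real.contDiff_exp.comp (by fun_prop)
  have H2 : ∀ n t, Monotone (fun p => Θ₂ n p t) := by
    intro n t p q hpq
    unfold Θ₂
    apply mul_le_mul
    · exact smoothTransition.monotone (by nlinarith [Nat.cast_nonneg (α := ℝ) n])
    · exact exp_le_exp.2 hpq
    · exact (exp_pos _).le
    · exact smoothTransition.nonneg _
  have H3 : ∀ n p, Monotone (fun t => Θ₂ n p t) := by
    intro n p s t hst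
    unfold Θ₂
    apply mul_le_mul_of_nonneg_right _ (exp_pos _).le
    exact smoothTransition.monotone (by nlinarith [Nat.cast_nonneg (α := ℝ) n])
  have H4 : ∀ p t, Antitone (fun n => Θ₂ n p t) := by
    intro p t m n hmn
    show Θ₂ n p t ≤ Θ₂ m p t
    rcases le_or_gt p (3 / 4 - t / 2) with hp | hp
    · unfold Θ₂
      apply mul_le_mul_of_nonneg_right _ (exp_pos _).le
      apply smoothTransition.monotone
      have : (m : ℝ) ≤ n := by exact_mod_cast hmn
      nlinarith
    · rw [Θ₂_right hp.le, Θ₂_right hp.le]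
  have H5 : ∀ n p t, 0 ≤ Θ₂ n p t := Θ₂_nonneg
  have H6 : ContinuousOn (fun t : ℝ => 3 / 4 - t / 2) (Set.Icc (1 / 4) (1 / 2)) := by fun_prop
  have H7 : ∀ t ∈ Set.Icc (1 / 4 : ℝ) (1 / 2),
      (1 / 4 : ℝ) < 3 / 4 - t / 2 ∧ 3 / 4 - t / 2 + 1 / 4 < 1 := by
    intro t ht; obtain ⟨h1, h2⟩ := ht; constructor <;> linarith
  have H8 : ∀ t ∈ Set.Icc (1 / 4 : ℝ) (1 / 2), ∀ p : ℝ,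
      (p < 3 / 4 - t / 2 → (⨅ n, Θ₂ n p t) = 0) ∧ (3 / 4 - t / 2 < p → 0 < ⨅ n, Θ₂ n p t) := by
    intro t _ p
    refine ⟨fun hp => iInf_Θ₂_left hp, fun hp => ?_⟩
    rw [iInf_Θ₂_right hp.le]
    exact exp_pos _
  have H9 : ContinuousOn (fun x : ℝ × ℝ => (0 : ℝ))
      {x : ℝ × ℝ | x.2 ∈ Set.Icc (1 / 4 : ℝ) (1 / 2) ∧ |x.1 - (3 / 4 - x.2 / 2)| ≤ 1 / 4} :=
    continuousOn_const
  have H10 : ∀ t ∈ Set.Icc (1 / 4 : ℝ) (1 / 2), ∀ p q : ℝ, 3 / 4 - t / 2 ≤ p →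
      p ≤ 3 / 4 - t / 2 + 1 / 4 → 3 / 4 - t / 2 ≤ q → q ≤ 3 / 4 - t / 2 + 1 / 4 →
      |(0 : ℝ) - 0| ≤ 0 * |p - q| := by
    intros; simp
  have H11 : ∀ η > (0 : ℝ), ∃ m : ℕ, ∀ n ≥ m, ∀ t ∈ Set.Icc (1 / 4 : ℝ) (1 / 2), ∀ p : ℝ,
      3 / 4 - t / 2 ≤ p → p ≤ 3 / 4 - t / 2 + 1 / 4 →
      |deriv (fun s => Θ₂ n p s) t - 0 * deriv (fun q => Θ₂ n q t) p|
        ≤ η * deriv (fun q => Θ₂ n q t) p := by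
    intro η hη
    refine ⟨0, fun n _ t _ p hp _ => ?_⟩
    have hx : 1 ≤ (n : ℝ) * (p + t / 2 - 3 / 4) + 1 := by
      have : 0 ≤ (n : ℝ) * (p + t / 2 - 3 / 4) := mul_nonneg (Nat.cast_nonneg n) (by linarith)
      linarith
    rw [Θ₂_deriv_t, Θ₂_deriv_p, ST_deriv_eq_zero hx, smoothTransition.one_of_one_le hx]
    have hpos : 0 ≤ η * exp p := mul_nonneg hη.le (exp_pos _).le
    rw [abs_le]
    constructor <;> nlinarith [hpos]
  have H12 : ∀ η > (0 : ℝ), ∃ δ > (0 : ℝ), ∃ m : ℕ, ∀ n ≥ m, ∀ t ∈ Set.Icc (1 / 4 : ℝ) (1 / 2),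
      ∀ p : ℝ, 3 / 4 - t / 2 - δ ≤ p → p ≤ 3 / 4 - t / 2 →
      -(η * deriv (fun q => Θ₂ n q t) p)
        ≤ deriv (fun s => Θ₂ n p s) t - 0 * deriv (fun q => Θ₂ n q t) p := by
    intro η hη
    refine ⟨1 / 4, by norm_num, 0, fun n _ t _ p _ _ => ?_⟩
    rw [Θ₂_deriv_t, Θ₂_deriv_p]
    have hS := ST_deriv_nonneg ((n : ℝ) * (p + t / 2 - 3 / 4) + 1)
    have hT := smoothTransition.nonneg ((n : ℝ) * (p + t / 2 - 3 / 4) + 1)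
    have hE := (exp_pos p).le
    have hn := Nat.cast_nonneg (α := ℝ) n
    have h1 : 0 ≤ deriv smoothTransition ((n : ℝ) * (p + t / 2 - 3 / 4) + 1) * n * exp p :=
      mul_nonneg (mul_nonneg hS hn) hE
    have h2 : 0 ≤ smoothTransition ((n : ℝ) * (p + t / 2 - 3 / 4) + 1) * exp p := mul_nonneg hT hE
    have h3 : 0 ≤ deriv smoothTransition ((n : ℝ) * (p + t / 2 - 3 / 4) + 1) * (n * (1 / 2)) * exp p :=
      mul_nonneg (mul_nonneg hS (by positivity)) hE
    nlinarith [mul_nonneg hη.le (add_nonneg h1 h2)]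
  have hJ := key H1 H2 H3 H4 H5 H6 H7 H8 H9 H10 H11 H12 (1 / 4) ⟨le_rfl, by norm_num⟩ (1 / 2)
    ⟨by norm_num, le_rfl⟩ (by norm_num)
  rw [iInf_Θ₂_right le_rfl, iInf_Θ₂_right le_rfl] at hJ
  have : exp ((3 : ℝ) / 4 - 1 / 2 / 2) < exp (3 / 4 - 1 / 4 / 2) := exp_lt_exp.2 (by norm_num)
  linarith

end Summit.CriticalPhenomena.PercolationContinuityZ3.Cruxes.TransportLemma.TimeArrow
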